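import Literature.Geometry.Riemannian.OneVariableDiagonalMetric
import Mathlib.Analysis.InnerProductSpace.Projection.FiniteDimensional
import Mathlib.Analysis.InnerProductSpace.Calculus
import Mathlib.Analysis.SpecialFunctions.Trigonometric.Deriv
import Mathlib.Analysis.SpecialFunctions.ExpDeriv
import HarnessLib

/-!
# The flat core model of the Gromov–Thurston `2π` smoothing and its polar identification

Support file (everything proved; no named fact, no `sorry`) for the Gromov–Thurston `2π` theorem
`Literature.Geometry.Riemannian.gromovThurston_twoPi_four` (`CuspedHyperbolic.lean`; Anderson
2006, §2.1, (2.4)). Pure multivariable calculus on `E4 = EuclideanSpace ℝ (Fin 4)` and linear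
algebra on `E3`; no manifolds.

Setting. A rank-`3` torus cusp of a hyperbolic `4`-manifold is `ℝ³/Λ × (t > -ε)` with the metric
`e^{-2t}⟨dx, dx⟩ + dt²`; a Dehn filling glues `T² × D̊²` to it, the point
`((e^{iθ₁}, e^{iθ₂}), r e^{iθ₃})` of the filling piece going to `(x, t)`,
`x = (θ₁ a₀ + θ₂ a₁ + θ₃ a₂)/2π`, `t = -log r`, where `(a₀, a₁, a₂)` is a basis of `Λ` whose last
vector `a₂` is the SLOPE, of flat length `L = ‖a₂‖` (`CuspedHyperbolic.lean`,
`TorusCusp.fillingRel`). This file provides: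

* `SlopeFrame a` — an orthonormal frame `(u₀, u₁, u₂)` of `E3` adapted to the slope,
  `u₂ = a₂/‖a₂‖` (`exists_slopeFrame`); the straightened cusp coordinates are
  `y_k = ⟨x, u_k⟩`, in which the cusp metric is the one-variable diagonal model
  `e^{-2t}(dy₀² + dy₁² + dy₂²) + dt²` of `OneVariableDiagonalMetric.lean`;
* `thetaToY` (`Lθ`) — the linear map `(θ₁, θ₂, θ₃, t) ↦ (y₀, y₁, y₂, t)`;
* `polarMap` (`Ξ`) — `(θ₁, θ₂, θ₃, t) ↦ (θ₁, θ₂, e^{-t} cos θ₃, e^{-t} sin θ₃)`, the passage from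
  cusp coordinates to the coordinates `(θ₁, θ₂, w₁, w₂)` of the filling piece `T² × D̊²`
  (`w = r e^{iθ₃}`, `r = e^{-t}`), with its derivative `polarDeriv` and its injectivity;
* `coreForm` (`F`) — the field of bilinear forms on `E4 ∋ (θ₁, θ₂, w₁, w₂)`
  `F = (κ/2π)² Σ_{k<2} ⟨α, u_k⟩² + λ² |dw + J w η|²`, `α = a₀ dθ₁ + a₁ dθ₂`,
  `η = ⟨α, a₂⟩/L²`, `J w = (-w₂, w₁)`: smooth (polynomial in `w`), symmetric, positive
  definite — the smooth flat metric of `T² × D²` near the core torus `w = 0`;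
* `coreForm_polar` — **the polar identification**: if the profile `c` has the flat-cone form
  `c₀ = c₁ = κ²`, `c₂ = λ²(2π/L)² e^{-2t}`, `c₃ = λ² e^{-2t}` at height `t`
  (`TwoPiProfile.exists_profile`), then
  `F(Ξ q)(DΞ V, DΞ W) = (diagonal model c)(Lθ q)(Lθ V, Lθ W)`: through `Ξ`, the smoothed cusp
  metric IS the smooth flat metric `F` on the punctured neighbourhood of the core, hence extends
  smoothly over the core torus (this is the cone-angle-`2π` computation of Anderson 2006, §2.1 /
  Bleiler–Hodgson 1996, proof of Thm. 9: `dr² + r² dθ₃² = |dw|²`).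

## References

* M. T. Anderson, *Dehn filling and Einstein metrics in higher dimensions*, J. Differential Geom.
  73 (2006) 219–261, §2.1. [Anderson2006]
* S. A. Bleiler, C. D. Hodgson, *Spherical space forms and Dehn filling*, Topology 35 (1996)
  809–833, proof of Thm. 9. [BleilerHodgson1996]
-/

noncomputable section

open Set Real Module ContinuousLinearMap
open scoped ContDiff InnerProductSpace

namespace Literature.Geometry.Riemannian

open Literature.Geometry.Lorentzian Literature.Geometry.Lorentzian.MetricCoord

namespace TwoPiCore

/-! ### Coordinates on `E4` -/

/-- The `i`-th coordinate functional of `E4`. [folklore] -/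
abbrev pr (i : Fin 4) : E4 →L[ℝ] ℝ := EuclideanSpace.proj i

/-- `pr i v = v i`. [folklore] -/
@[simp] theorem pr_apply (i : Fin 4) (v : E4) : pr i v = v i := rfl

/-- The point of `E4` with the given four coordinates. [folklore] -/
def mk4 (x₀ x₁ x₂ x₃ : ℝ) : E4 := WithLp.toLp 2 ![x₀, x₁, x₂, x₃]

/-- Coordinate `0` of `mk4`. [folklore] -/
@[simp] theorem mk4_apply_zero (x₀ x₁ x₂ x₃ : ℝ) : mk4 x₀ x₁ x₂ x₃ 0 = x₀ := rfl
/-- Coordinate `1` of `mk4`. [folklore] -/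
@[simp] theorem mk4_apply_one (x₀ x₁ x₂ x₃ : ℝ) : mk4 x₀ x₁ x₂ x₃ 1 = x₁ := rfl
/-- Coordinate `2` of `mk4`. [folklore] -/
@[simp] theorem mk4_apply_two (x₀ x₁ x₂ x₃ : ℝ) : mk4 x₀ x₁ x₂ x₃ 2 = x₂ := rfl
/-- Coordinate `3` of `mk4`. [folklore] -/
@[simp] theorem mk4_apply_three (x₀ x₁ x₂ x₃ : ℝ) : mk4 x₀ x₁ x₂ x₃ 3 = x₃ := rfl

/-- Two points of `E4` with the same four coordinates are equal (file-local helper; the same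
statement exists as `LegendrianDarboux.euclidean_four_ext` in an unrelated topic file). [folklore] -/
private theorem ext4 {v w : E4} (h0 : v 0 = w 0) (h1 : v 1 = w 1) (h2 : v 2 = w 2) (h3 : v 3 = w 3) :
    v = w := by
  ext i
  fin_cases i <;> assumption

/-- The vector `∑ᵢ fᵢ(v) eᵢ` assembled from four functionals, as a continuous linear map. [folklore] -/
def clm4 (f₀ f₁ f₂ f₃ : E4 →L[ℝ] ℝ) : E4 →L[ℝ] E4 :=
  f₀.smulRight (eb 0) + f₁.smulRight (eb 1) + f₂.smulRight (eb 2) + f₃.smulRight (eb 3)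

/-- Coordinates of `clm4`. [folklore] -/
theorem clm4_apply (f₀ f₁ f₂ f₃ : E4 →L[ℝ] ℝ) (v : E4) :
    clm4 f₀ f₁ f₂ f₃ v = mk4 (f₀ v) (f₁ v) (f₂ v) (f₃ v) := by
  apply ext4 <;> simp [clm4, mk4]

/-! ### The orthonormal frame adapted to the slope -/

/-- **A slope frame**: an orthonormal frame `(u₀, u₁, u₂)` of `E3` whose last vector is the unit
vector of the slope `a 2`. The straightened cusp coordinates are `y_k = ⟨x, u_k⟩`. [folklore] -/
structure SlopeFrame (a : Fin 3 → E3) where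
  /-- The frame vectors. -/
  u : Fin 3 → E3
  /-- The frame is orthonormal. -/
  orthonormal : Orthonormal ℝ u
  /-- The last frame vector is the normalised slope. -/
  u_two : u 2 = ‖a 2‖⁻¹ • a 2

/-- **Existence of a slope frame** for a non-zero slope: complete `a₂/‖a₂‖` by an orthonormal
basis of its orthogonal complement (a plane). [folklore] -/
theorem exists_slopeFrame {a : Fin 3 → E3} (h : a 2 ≠ 0) : Nonempty (SlopeFrame a) := by
  set v : E3 := a 2 with hv
  set K : Submodule ℝ E3 := (ℝ ∙ v)ᗮ with hK
  haveI : Fact (finrank ℝ E3 = 2 + 1) := ⟨by simp⟩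
  have hK2 : finrank ℝ K = 2 := Submodule.finrank_orthogonal_span_singleton h
  let b : OrthonormalBasis (Fin 2) ℝ K := (stdOrthonormalBasis ℝ K).reindex (finCongr hK2)
  have hbb : ∀ i j : Fin 2, ⟪(b i : E3), (b j : E3)⟫_ℝ = if i = j then 1 else 0 := by
    intro i j
    rw [← Submodule.coe_inner, orthonormal_iff_ite.1 b.orthonormal i j]
  have hvb : ∀ i : Fin 2, ⟪v, (b i : E3)⟫_ℝ = 0 := fun i ↦
    Submodule.mem_orthogonal_singleton_iff_inner_right.1 (b i).2
  have hbv : ∀ i : Fin 2, ⟪(b i : E3), v⟫_ℝ = 0 := fun i ↦ by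
    rw [real_inner_comm]; exact hvb i
  have hn : ‖v‖ ≠ 0 := norm_ne_zero_iff.2 h
  have hb1 : ∀ i : Fin 2, ‖(b i : E3)‖ = 1 := fun i ↦ b.orthonormal.1 i
  have hvn : ‖‖v‖⁻¹ • v‖ = 1 := by
    rw [norm_smul, norm_inv, norm_norm, inv_mul_cancel₀ hn]
  have h01 : ⟪(b 0 : E3), (b 1 : E3)⟫_ℝ = 0 := by simpa using hbb 0 1
  have h10 : ⟪(b 1 : E3), (b 0 : E3)⟫_ℝ = 0 := by simpa using hbb 1 0
  refine ⟨⟨![(b 0 : E3), (b 1 : E3), ‖v‖⁻¹ • v], ?_, rfl⟩⟩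
  classical
  rw [orthonormal_iff_ite]
  intro i j
  fin_cases i <;> fin_cases j <;>
    simp [hb1, hvn, h01, h10, hvb, hbv, inner_smul_left, inner_smul_right]

namespace SlopeFrame

variable {a : Fin 3 → E3} (fr : SlopeFrame a)

/-- `⟨u_i, u_j⟩ = δ_ij`. [folklore] -/
theorem inner_u_u (i j : Fin 3) : ⟪fr.u i, fr.u j⟫_ℝ = if i = j then 1 else 0 := by
  classical
  exact orthonormal_iff_ite.1 fr.orthonormal i j

/-- The frame as an orthonormal basis of `E3` (three orthonormal vectors). [folklore] -/
def basis : OrthonormalBasis (Fin 3) ℝ E3 :=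
  OrthonormalBasis.mk fr.orthonormal
    (by rw [fr.orthonormal.linearIndependent.span_eq_top_of_card_eq_finrank (by simp)])

/-- The orthonormal basis is the frame. [folklore] -/
@[simp] theorem coe_basis : ⇑fr.basis = fr.u := OrthonormalBasis.coe_mk _ _

/-- **Expansion in the frame**: `x = ∑_k ⟨x, u_k⟩ u_k`. [folklore] -/
theorem sum_inner_smul (x : E3) : ∑ k, ⟪x, fr.u k⟫_ℝ • fr.u k = x := by
  have h := fr.basis.sum_repr' x
  simp only [coe_basis] at h
  conv_rhs => rw [← h]
  refine Finset.sum_congr rfl fun k _ ↦ ?_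
  rw [real_inner_comm]

/-- The scalar product of two frame expansions: `⟨∑ y_k u_k, ∑ z_k u_k⟩ = ∑ y_k z_k`. [folklore] -/
theorem inner_sum_smul (y z : Fin 3 → ℝ) :
    ⟪∑ k, y k • fr.u k, ∑ k, z k • fr.u k⟫_ℝ = ∑ k, y k * z k := by
  rw [fr.orthonormal.inner_sum]
  simp

/-- The slope is orthogonal to `u₀`. [folklore] -/
theorem inner_a_two_u_zero : ⟪a 2, fr.u 0⟫_ℝ = 0 := by
  by_cases h : a 2 = 0
  · simp [h]
  · have h1 := fr.inner_u_u 2 0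
    rw [fr.u_two, inner_smul_left] at h1
    simpa [norm_ne_zero_iff.2 h] using h1

/-- The slope is orthogonal to `u₁`. [folklore] -/
theorem inner_a_two_u_one : ⟪a 2, fr.u 1⟫_ℝ = 0 := by
  by_cases h : a 2 = 0
  · simp [h]
  · have h1 := fr.inner_u_u 2 1
    rw [fr.u_two, inner_smul_left] at h1
    simpa [norm_ne_zero_iff.2 h] using h1

/-- `⟨a₂, u₂⟩ = ‖a₂‖ = L`, the slope length. [folklore] -/
theorem inner_a_two_u_two : ⟪a 2, fr.u 2⟫_ℝ = ‖a 2‖ := by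
  rw [fr.u_two, inner_smul_right, real_inner_self_eq_norm_sq]
  by_cases h : a 2 = 0
  · simp [h]
  · field_simp [norm_ne_zero_iff.2 h]

/-- `a₂ = ‖a₂‖ u₂`. [folklore] -/
theorem a_two_eq : a 2 = ‖a 2‖ • fr.u 2 := by
  rw [fr.u_two, smul_smul]
  by_cases h : a 2 = 0
  · simp [h]
  · rw [mul_inv_cancel₀ (norm_ne_zero_iff.2 h), one_smul]

/-- `⟨x, a₂⟩ = L ⟨x, u₂⟩`. [folklore] -/
theorem inner_a_two_right (x : E3) : ⟪x, a 2⟫_ℝ = ‖a 2‖ * ⟪x, fr.u 2⟫_ℝ := by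
  conv_lhs => rw [fr.a_two_eq, inner_smul_right]

end SlopeFrame

/-! ### The maps `Lθ` and `Ξ` -/

section Maps

variable {a : Fin 3 → E3} (fr : SlopeFrame a)

/-- The cusp point `x(q) = (q₀ a₀ + q₁ a₁ + q₂ a₂)/2π ∈ E3` over the angles `(θ₁, θ₂, θ₃) =
(q₀, q₁, q₂)` (Anderson 2006, §2.1; `TorusCusp.fillingRel`). [cite: Anderson2006, §2.1, (2.2)] -/
def xTheta (a : Fin 3 → E3) (q : E4) : E3 :=
  (2 * π)⁻¹ • (q 0 • a 0 + q 1 • a 1 + q 2 • a 2)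

namespace SlopeFrame

/-- The `k`-th straightened coordinate functional `q ↦ ⟨x(q), u_k⟩`. [folklore] -/
def yFun (k : Fin 3) : E4 →L[ℝ] ℝ :=
  (2 * π)⁻¹ • (⟪a 0, fr.u k⟫_ℝ • pr 0 + ⟪a 1, fr.u k⟫_ℝ • pr 1 + ⟪a 2, fr.u k⟫_ℝ • pr 2)

/-- `yFun k q = ⟨x(q), u_k⟩`. [folklore] -/
theorem yFun_apply (k : Fin 3) (q : E4) : fr.yFun k q = ⟪xTheta a q, fr.u k⟫_ℝ := by
  simp [yFun, xTheta, inner_smul_left, inner_add_left]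
  ring

/-- **`Lθ`**: the linear change from angle-height coordinates `(θ₁, θ₂, θ₃, t)` to straightened
cusp coordinates `(y₀, y₁, y₂, t)`, `y_k = ⟨x(θ), u_k⟩`. [folklore] -/
def thetaToY : E4 →L[ℝ] E4 :=
  clm4 (fr.yFun 0) (fr.yFun 1) (fr.yFun 2) (pr 3)

/-- Coordinates of `Lθ q`. [folklore] -/
theorem thetaToY_apply (q : E4) :
    fr.thetaToY q = mk4 ⟪xTheta a q, fr.u 0⟫_ℝ ⟪xTheta a q, fr.u 1⟫_ℝ ⟪xTheta a q, fr.u 2⟫_ℝ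
      (q 3) := by
  rw [thetaToY, clm4_apply, yFun_apply, yFun_apply, yFun_apply, pr_apply]

/-- `(Lθ q)_k = ⟨x(q), u_k⟩` for `k < 3`. [folklore] -/
theorem thetaToY_apply_castSucc (q : E4) (k : Fin 3) :
    fr.thetaToY q (Fin.castSucc k) = ⟪xTheta a q, fr.u k⟫_ℝ := by
  rw [thetaToY_apply]
  fin_cases k <;> rfl

/-- `(Lθ q)₃ = q₃` (the height is kept). [folklore] -/
@[simp] theorem thetaToY_apply_three (q : E4) : fr.thetaToY q 3 = q 3 := by
  rw [thetaToY_apply]; rfl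

/-- **`Φ ∘ Lθ` lands on the cusp point**: `∑_k (Lθ q)_k u_k = x(q)`. [folklore] -/
theorem sum_thetaToY_smul (q : E4) : ∑ k : Fin 3, fr.thetaToY q (Fin.castSucc k) • fr.u k =
    xTheta a q := by
  simp only [thetaToY_apply_castSucc]
  exact fr.sum_inner_smul _

end SlopeFrame

/-- **`Ξ`**, the polar map `(θ₁, θ₂, θ₃, t) ↦ (θ₁, θ₂, e^{-t} cos θ₃, e^{-t} sin θ₃)`: cusp
coordinates to filling-piece coordinates `(θ₁, θ₂, w₁, w₂)`, `w = r e^{iθ₃}`, `r = e^{-t}`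
(`TorusCusp.fillingRel`). [cite: Anderson2006, §2.1, (2.2)] -/
def polarMap (q : E4) : E4 :=
  mk4 (q 0) (q 1) (exp (-q 3) * cos (q 2)) (exp (-q 3) * sin (q 2))

/-- `Ξ` keeps `θ₁`. [folklore] -/
@[simp] theorem polarMap_apply_zero (q : E4) : polarMap q 0 = q 0 := rfl
/-- `Ξ` keeps `θ₂`. [folklore] -/
@[simp] theorem polarMap_apply_one (q : E4) : polarMap q 1 = q 1 := rfl
/-- `w₁ = e^{-t} cos θ₃`. [folklore] -/
@[simp] theorem polarMap_apply_two (q : E4) : polarMap q 2 = exp (-q 3) * cos (q 2) := rfl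
/-- `w₂ = e^{-t} sin θ₃`. [folklore] -/
@[simp] theorem polarMap_apply_three (q : E4) : polarMap q 3 = exp (-q 3) * sin (q 2) := rfl

/-- `|w|² = e^{-2t}` on the image of `Ξ`. [folklore] -/
theorem polarMap_sq_add_sq (q : E4) :
    polarMap q 2 ^ 2 + polarMap q 3 ^ 2 = exp (-q 3) ^ 2 := by
  simp only [polarMap_apply_two, polarMap_apply_three]
  nlinarith [sin_sq_add_cos_sq (q 2)]

/-- **The derivative `DΞ_q`** as a continuous linear map:
`V ↦ (V₀, V₁, e^{-t}(-sin θ₃ V₂ - cos θ₃ V₃), e^{-t}(cos θ₃ V₂ - sin θ₃ V₃))`. [folklore] -/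
def polarDeriv (q : E4) : E4 →L[ℝ] E4 :=
  clm4 (pr 0) (pr 1)
    ((-(exp (-q 3) * sin (q 2))) • pr 2 + (-(exp (-q 3) * cos (q 2))) • pr 3)
    ((exp (-q 3) * cos (q 2)) • pr 2 + (-(exp (-q 3) * sin (q 2))) • pr 3)

/-- Coordinates of `DΞ_q V`. [folklore] -/
theorem polarDeriv_apply (q V : E4) :
    polarDeriv q V = mk4 (V 0) (V 1)
      (exp (-q 3) * (-sin (q 2) * V 2 - cos (q 2) * V 3))
      (exp (-q 3) * (cos (q 2) * V 2 - sin (q 2) * V 3)) := by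
  rw [polarDeriv, clm4_apply]
  congr 1 <;> simp <;> ring

/-- A scalar function of the coordinates `q₂, q₃` has the expected derivative. [folklore] -/
theorem hasFDerivAt_exp_mul {f f' : ℝ → ℝ} (hf : ∀ x, HasDerivAt f (f' x) x) (q : E4) :
    HasFDerivAt (fun q : E4 ↦ exp (-q 3) * f (q 2))
      ((exp (-q 3) * f' (q 2)) • pr 2 + (-(exp (-q 3) * f (q 2))) • pr 3) q := by
  have hneg : HasFDerivAt (fun q : E4 ↦ -q 3) (-pr 3) q := (pr 3).hasFDerivAt.neg
  have h3 : HasFDerivAt (fun q : E4 ↦ exp (-q 3)) (exp (-q 3) • (-pr 3)) q := by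
    have := (Real.hasDerivAt_exp (-q 3)).comp_hasFDerivAt q hneg
    exact this
  have h2 : HasFDerivAt (fun q : E4 ↦ f (q 2)) (f' (q 2) • pr 2) q :=
    (hf (q 2)).comp_hasFDerivAt q (pr 2).hasFDerivAt
  refine (h3.mul h2).congr_fderiv ?_
  refine ContinuousLinearMap.ext fun v ↦ ?_
  simp only [_root_.add_apply, _root_.smul_apply, _root_.neg_apply, pr_apply, smul_eq_mul]
  ring

/-- **`Ξ` is differentiable with derivative `polarDeriv`.** [folklore] -/
theorem hasFDerivAt_polarMap (q : E4) : HasFDerivAt polarMap (polarDeriv q) q := by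
  have h0 : HasFDerivAt (fun q : E4 ↦ (q 0) • (eb 0 : E4)) ((pr 0).smulRight (eb 0)) q :=
    (pr 0).hasFDerivAt.smul_const _
  have h1 : HasFDerivAt (fun q : E4 ↦ (q 1) • (eb 1 : E4)) ((pr 1).smulRight (eb 1)) q :=
    (pr 1).hasFDerivAt.smul_const _
  have h2 := (hasFDerivAt_exp_mul (f := cos) (f' := fun x ↦ -sin x) Real.hasDerivAt_cos q).smul_const
    (eb 2 : E4)
  have h3 := (hasFDerivAt_exp_mul (f := sin) (f' := cos) Real.hasDerivAt_sin q).smul_const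
    (eb 3 : E4)
  have h := ((h0.add h1).add h2).add h3
  have hD : (pr 0).smulRight (eb 0 : E4) + (pr 1).smulRight (eb 1 : E4) +
      ((exp (-q 3) * -sin (q 2)) • pr 2 + (-(exp (-q 3) * cos (q 2))) • pr 3).smulRight
        (eb 2 : E4) +
      ((exp (-q 3) * cos (q 2)) • pr 2 + (-(exp (-q 3) * sin (q 2))) • pr 3).smulRight
        (eb 3 : E4) = polarDeriv q := by
    refine ContinuousLinearMap.ext fun v ↦ ?_
    rw [polarDeriv_apply]
    apply ext4 <;> simp [mk4] <;> ring
  rw [hD] at h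
  refine h.congr_of_eventuallyEq (Filter.Eventually.of_forall fun q ↦ ?_)
  apply ext4 <;> simp [polarMap, mk4]

/-- `Ξ` is smooth. [folklore] -/
theorem contDiff_polarMap : ContDiff ℝ ∞ polarMap := by
  rw [contDiff_euclidean]
  intro i
  fin_cases i
  · exact (pr 0).contDiff
  · exact (pr 1).contDiff
  · exact ((pr 3).contDiff.neg.exp).mul (Real.contDiff_cos.comp (pr 2).contDiff)
  · exact ((pr 3).contDiff.neg.exp).mul (Real.contDiff_sin.comp (pr 2).contDiff)

/-- `fderiv Ξ = polarDeriv`. [folklore] -/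
theorem fderiv_polarMap (q : E4) : fderiv ℝ polarMap q = polarDeriv q :=
  (hasFDerivAt_polarMap q).fderiv

/-- **`DΞ_q` is injective** (its determinant is `e^{-2t} ≠ 0`). [folklore] -/
theorem polarDeriv_injective (q : E4) : Function.Injective (polarDeriv q) := by
  intro V W h
  have h' : ∀ i, polarDeriv q V i = polarDeriv q W i := fun i ↦ by rw [h]
  have e0 := h' 0
  have e1 := h' 1
  have e2 := h' 2
  have e3 := h' 3
  simp only [polarDeriv_apply, mk4_apply_zero, mk4_apply_one, mk4_apply_two,
    mk4_apply_three] at e0 e1 e2 e3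
  have he : exp (-q 3) ≠ 0 := (exp_pos _).ne'
  have e2' : -sin (q 2) * V 2 - cos (q 2) * V 3 = -sin (q 2) * W 2 - cos (q 2) * W 3 :=
    mul_left_cancel₀ he e2
  have e3' : cos (q 2) * V 2 - sin (q 2) * V 3 = cos (q 2) * W 2 - sin (q 2) * W 3 :=
    mul_left_cancel₀ he e3
  have hcs := sin_sq_add_cos_sq (q 2)
  have k2 : (sin (q 2) ^ 2 + cos (q 2) ^ 2) * (V 2 - W 2) = 0 := by
    linear_combination (-sin (q 2)) * e2' + cos (q 2) * e3'
  have k3 : (sin (q 2) ^ 2 + cos (q 2) ^ 2) * (V 3 - W 3) = 0 := by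
    linear_combination (-cos (q 2)) * e2' + (-sin (q 2)) * e3'
  rw [hcs, one_mul, sub_eq_zero] at k2 k3
  exact ext4 e0 e1 k2 k3

/-- Every point `(θ₁, θ₂, w)` with `w ≠ 0` is in the image of `Ξ`: `w = e^{-t}(cos θ₃, sin θ₃)`
with `t = -log |w|`, `θ₃ = arg w`. [folklore] -/
theorem exists_polarMap_eq (p : E4) (hp : p 2 ≠ 0 ∨ p 3 ≠ 0) :
    ∃ q : E4, polarMap q = p ∧ q 3 = -Real.log (√(p 2 ^ 2 + p 3 ^ 2)) := by
  set z : ℂ := ⟨p 2, p 3⟩ with hz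
  have hz0 : z ≠ 0 := by
    intro h0
    rw [Complex.ext_iff] at h0
    simp only [Complex.zero_re, Complex.zero_im] at h0
    rcases hp with h | h
    · exact h h0.1
    · exact h h0.2
  have hr : ‖z‖ = √(p 2 ^ 2 + p 3 ^ 2) := by
    rw [Complex.norm_eq_sqrt_sq_add_sq]
  have hrpos : 0 < ‖z‖ := norm_pos_iff.2 hz0
  refine ⟨mk4 (p 0) (p 1) (Complex.arg z) (-Real.log ‖z‖), ?_, by rw [hr]; rfl⟩
  have hexp : exp (-(-Real.log ‖z‖)) = ‖z‖ := by rw [neg_neg, Real.exp_log hrpos]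
  apply ext4
  · rfl
  · rfl
  · simp only [polarMap_apply_two, mk4_apply_three, mk4_apply_two, hexp, Complex.cos_arg hz0]
    field_simp
    rfl
  · simp only [polarMap_apply_three, mk4_apply_three, mk4_apply_two, hexp, Complex.sin_arg]
    field_simp
    rfl

end Maps

/-! ### The flat core form `F` -/

section Core

variable {a : Fin 3 → E3} (fr : SlopeFrame a)

/-- The rank-one form `(V, W) ↦ ℓ(V) ℓ(W)` of a functional `ℓ`. [folklore] -/
def sqForm (ℓ : E4 →L[ℝ] ℝ) : E4 →L[ℝ] E4 →L[ℝ] ℝ := ℓ.smulRight ℓ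

/-- `sqForm ℓ V W = ℓ V · ℓ W`. [folklore] -/
@[simp] theorem sqForm_apply (ℓ : E4 →L[ℝ] ℝ) (V W : E4) : sqForm ℓ V W = ℓ V * ℓ W := by
  simp [sqForm]

/-- `q ↦ sqForm (ℓ q)` is smooth when `ℓ` is. [folklore] -/
theorem contDiff_sqForm {ℓ : E4 → E4 →L[ℝ] ℝ} (h : ContDiff ℝ ∞ ℓ) :
    ContDiff ℝ ∞ fun q ↦ sqForm (ℓ q) :=
  h.smulRight h

/-- The twist functional `η(V) = ⟨V₀ a₀ + V₁ a₁, a₂⟩ / L²` (`L = ‖a₂‖`): the rotation of the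
filling disc per unit angle of the `T²`-factor, i.e. the component of `a₀ dθ₁ + a₁ dθ₂` along the
slope. [folklore] -/
def etaFun (a : Fin 3 → E3) : E4 →L[ℝ] ℝ :=
  (‖a 2‖ ^ 2)⁻¹ • (⟪a 0, a 2⟫_ℝ • pr 0 + ⟪a 1, a 2⟫_ℝ • pr 1)

/-- `η(V) = (⟨a₀, a₂⟩ V₀ + ⟨a₁, a₂⟩ V₁)/L²`. [folklore] -/
theorem etaFun_apply (V : E4) :
    etaFun a V = (‖a 2‖ ^ 2)⁻¹ * (⟪a 0, a 2⟫_ℝ * V 0 + ⟪a 1, a 2⟫_ℝ * V 1) := by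
  simp [etaFun]
  ring

/-- `η` only reads the first two coordinates; in particular `η(DΞ V) = η(V)`. [folklore] -/
theorem etaFun_polarDeriv (q V : E4) : etaFun a (polarDeriv q V) = etaFun a V := by
  simp only [etaFun_apply, polarDeriv_apply, mk4_apply_zero, mk4_apply_one]

namespace SlopeFrame

/-- The functional `φ_k(V) = ⟨V₀ a₀ + V₁ a₁, u_k⟩` (the `u_k`-component of `a₀ dθ₁ + a₁ dθ₂`).
[folklore] -/
def phiFun (k : Fin 3) : E4 →L[ℝ] ℝ := ⟪a 0, fr.u k⟫_ℝ • pr 0 + ⟪a 1, fr.u k⟫_ℝ • pr 1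

/-- `φ_k(V) = ⟨a₀, u_k⟩ V₀ + ⟨a₁, u_k⟩ V₁`. [folklore] -/
theorem phiFun_apply (k : Fin 3) (V : E4) :
    fr.phiFun k V = ⟪a 0, fr.u k⟫_ℝ * V 0 + ⟪a 1, fr.u k⟫_ℝ * V 1 := by
  simp [phiFun]

/-- `φ_k` only reads the first two coordinates: `φ_k(DΞ V) = φ_k(V)`. [folklore] -/
theorem phiFun_polarDeriv (k : Fin 3) (q V : E4) : fr.phiFun k (polarDeriv q V) = fr.phiFun k V := by
  simp only [phiFun_apply, polarDeriv_apply, mk4_apply_zero, mk4_apply_one]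

/-- For `k = 0, 1`: `⟨x(V), u_k⟩ = φ_k(V)/2π` (the slope component drops out since
`a₂ ⊥ u₀, u₁`). [folklore] -/
theorem inner_xTheta_u_zero (V : E4) : ⟪xTheta a V, fr.u 0⟫_ℝ = (2 * π)⁻¹ * fr.phiFun 0 V := by
  rw [← fr.yFun_apply, phiFun_apply]
  simp [SlopeFrame.yFun, fr.inner_a_two_u_zero]
  ring

/-- Companion of `inner_xTheta_u_zero` for `u₁`. [folklore] -/
theorem inner_xTheta_u_one (V : E4) : ⟪xTheta a V, fr.u 1⟫_ℝ = (2 * π)⁻¹ * fr.phiFun 1 V := by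
  rw [← fr.yFun_apply, phiFun_apply]
  simp [SlopeFrame.yFun, fr.inner_a_two_u_one]
  ring

/-- `⟨x(V), u₂⟩ = (⟨a₀,u₂⟩ V₀ + ⟨a₁,u₂⟩ V₁ + L V₂)/2π`. [folklore] -/
theorem inner_xTheta_u_two (V : E4) : ⟪xTheta a V, fr.u 2⟫_ℝ =
    (2 * π)⁻¹ * (⟪a 0, fr.u 2⟫_ℝ * V 0 + ⟪a 1, fr.u 2⟫_ℝ * V 1 + ‖a 2‖ * V 2) := by
  rw [← fr.yFun_apply]
  simp [SlopeFrame.yFun, fr.inner_a_two_u_two]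
  ring

/-- `L η(V) = ⟨a₀, u₂⟩ V₀ + ⟨a₁, u₂⟩ V₁` (for `a₂ ≠ 0`). [folklore] -/
theorem norm_mul_etaFun (hL : a 2 ≠ 0) (V : E4) :
    ‖a 2‖ * etaFun a V = ⟪a 0, fr.u 2⟫_ℝ * V 0 + ⟪a 1, fr.u 2⟫_ℝ * V 1 := by
  rw [etaFun_apply, fr.inner_a_two_right (a 0), fr.inner_a_two_right (a 1)]
  have hn : ‖a 2‖ ≠ 0 := norm_ne_zero_iff.2 hL
  field_simp

/-- **The core form `F`** on `E4 ∋ (θ₁, θ₂, w₁, w₂)`: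
`F = (κ/2π)² (φ₀² + φ₁²) + λ² ((dw₁ - w₂ η)² + (dw₂ + w₁ η)²)` — the flat metric of
`ℝ² × ℝ² ⊇ ℝ² × D²` obtained from `κ²(dy₀² + dy₁²) + λ²|dw'|²` by the screw motion
`w' = R(η·θ) w`; constant in `θ`, polynomial in `w`, hence smooth across the core `w = 0`.
[cite: Anderson2006, §2.1, (2.4)] -/
def coreForm (κ lam : ℝ) (q : E4) : E4 →L[ℝ] E4 →L[ℝ] ℝ :=
  (κ / (2 * π)) ^ 2 • (sqForm (fr.phiFun 0) + sqForm (fr.phiFun 1)) +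
    lam ^ 2 • (sqForm (pr 2 - (q 3) • etaFun a) + sqForm (pr 3 + (q 2) • etaFun a))

/-- The value of the core form. [folklore] -/
theorem coreForm_apply (κ lam : ℝ) (q V W : E4) :
    fr.coreForm κ lam q V W =
      (κ / (2 * π)) ^ 2 * (fr.phiFun 0 V * fr.phiFun 0 W + fr.phiFun 1 V * fr.phiFun 1 W) +
        lam ^ 2 * ((V 2 - q 3 * etaFun a V) * (W 2 - q 3 * etaFun a W) +
          (V 3 + q 2 * etaFun a V) * (W 3 + q 2 * etaFun a W)) := by
  simp [coreForm]
  ring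

/-- The core form is symmetric. [folklore] -/
theorem coreForm_symm (κ lam : ℝ) (q V W : E4) :
    fr.coreForm κ lam q V W = fr.coreForm κ lam q W V := by
  rw [coreForm_apply, coreForm_apply]
  ring

/-- **The core form is smooth** (polynomial in `q`). [folklore] -/
theorem contDiff_coreForm (κ lam : ℝ) : ContDiff ℝ ∞ (fr.coreForm κ lam) := by
  have h1 : ContDiff ℝ ∞ fun q : E4 ↦ sqForm (pr 2 - (q 3) • etaFun a) :=
    contDiff_sqForm (contDiff_const.sub (((pr 3).contDiff).smul contDiff_const))
  have h2 : ContDiff ℝ ∞ fun q : E4 ↦ sqForm (pr 3 + (q 2) • etaFun a) :=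
    contDiff_sqForm (contDiff_const.add (((pr 2).contDiff).smul contDiff_const))
  have h3 : ContDiff ℝ ∞ fun q : E4 ↦
      lam ^ 2 • (sqForm (pr 2 - (q 3) • etaFun a) + sqForm (pr 3 + (q 2) • etaFun a)) :=
    (h1.add h2).const_smul (lam ^ 2)
  have h4 : ContDiff ℝ ∞ fun _ : E4 ↦
      (κ / (2 * π)) ^ 2 • (sqForm (fr.phiFun 0) + sqForm (fr.phiFun 1)) := contDiff_const
  exact h4.add h3

/-- The core form only depends on the disc coordinates `(q₂, q₃)`, not on the angles. [folklore] -/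
theorem coreForm_congr (κ lam : ℝ) {q q' : E4} (h2 : q 2 = q' 2) (h3 : q 3 = q' 3) :
    fr.coreForm κ lam q = fr.coreForm κ lam q' := by
  simp only [coreForm, h2, h3]

/-- `V₀ a₀ + V₁ a₁` has no `u₀`- and `u₁`-component only if `V₀ = V₁ = 0` (since `a` is a basis
and `u₀, u₁` span `a₂^⊥`). [folklore] -/
theorem eq_zero_of_phiFun_eq_zero (hind : LinearIndependent ℝ a) (V : E4)
    (h0 : fr.phiFun 0 V = 0) (h1 : fr.phiFun 1 V = 0) : V 0 = 0 ∧ V 1 = 0 := by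
  set α : E3 := V 0 • a 0 + V 1 • a 1 with hα
  have hk : ∀ k, fr.phiFun k V = ⟪α, fr.u k⟫_ℝ := fun k ↦ by
    simp [phiFun_apply, hα, inner_add_left, inner_smul_left, mul_comm]
  rw [hk] at h0 h1
  -- expand `α` in the frame: only the `u₂`-component survives
  have hexp := fr.sum_inner_smul α
  rw [Fin.sum_univ_three, h0, h1, zero_smul, zero_smul, zero_add, zero_add] at hexp
  -- a vanishing linear combination of the basis `a`
  set c : ℝ := ⟪α, fr.u 2⟫_ℝ * ‖a 2‖⁻¹ with hc
  have hexp' : c • a 2 = α := by rw [hc, ← smul_smul, ← fr.u_two]; exact hexp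
  have hcomb : ∑ i, (![V 0, V 1, -c] : Fin 3 → ℝ) i • a i = 0 := by
    rw [Fin.sum_univ_three]
    simp only [Matrix.cons_val_zero, Matrix.cons_val_one, Matrix.cons_val]
    rw [neg_smul, hexp', hα]
    abel
  have h := Fintype.linearIndependent_iff.1 hind _ hcomb
  exact ⟨by simpa using h 0, by simpa using h 1⟩

/-- **The core form is positive definite** (for `κ, λ ≠ 0` and `a` a basis). [folklore] -/
theorem coreForm_pos (hind : LinearIndependent ℝ a) {κ lam : ℝ} (hκ : κ ≠ 0) (hlam : lam ≠ 0)
    (q V : E4) (hV : V ≠ 0) : 0 < fr.coreForm κ lam q V V := by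
  rw [coreForm_apply]
  have hc : 0 < (κ / (2 * π)) ^ 2 := by positivity
  have hl : 0 < lam ^ 2 := by positivity
  have hA2 := mul_self_nonneg (fr.phiFun 0 V)
  have hB2 := mul_self_nonneg (fr.phiFun 1 V)
  have hC2 := mul_self_nonneg (V 2 - q 3 * etaFun a V)
  have hD2 := mul_self_nonneg (V 3 + q 2 * etaFun a V)
  have hX := mul_nonneg hc.le (add_nonneg hA2 hB2)
  have hY := mul_nonneg hl.le (add_nonneg hC2 hD2)
  by_contra hle
  rw [not_lt] at hle
  have hX0 : (κ / (2 * π)) ^ 2 * (fr.phiFun 0 V * fr.phiFun 0 V + fr.phiFun 1 V * fr.phiFun 1 V)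
      = 0 := by linarith
  have hY0 : lam ^ 2 * ((V 2 - q 3 * etaFun a V) * (V 2 - q 3 * etaFun a V) +
      (V 3 + q 2 * etaFun a V) * (V 3 + q 2 * etaFun a V)) = 0 := by linarith
  have hAB := (mul_eq_zero.1 hX0).resolve_left hc.ne'
  have hCD := (mul_eq_zero.1 hY0).resolve_left hl.ne'
  have hA : fr.phiFun 0 V = 0 := mul_self_eq_zero.1 (by linarith)
  have hB : fr.phiFun 1 V = 0 := mul_self_eq_zero.1 (by linarith)
  have hC : V 2 - q 3 * etaFun a V = 0 := mul_self_eq_zero.1 (by linarith)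
  have hD : V 3 + q 2 * etaFun a V = 0 := mul_self_eq_zero.1 (by linarith)
  obtain ⟨hV0, hV1⟩ := fr.eq_zero_of_phiFun_eq_zero hind V hA hB
  have hη : etaFun a V = 0 := by rw [etaFun_apply, hV0, hV1]; ring
  rw [hη, mul_zero, sub_zero] at hC
  rw [hη, mul_zero, add_zero] at hD
  exact hV (ext4 hV0 hV1 hC hD)

/-! ### The polar identification -/

/-- Normal form of the core form on the image of `DΞ`: the `λ²`-part is
`λ² e^{-2t} (sin² + cos²)((V₂ + η_V)(W₂ + η_W) + V₃ W₃)`. [folklore] -/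
theorem coreForm_polar_lhs (κ lam : ℝ) (q V W : E4) :
    fr.coreForm κ lam (polarMap q) (polarDeriv q V) (polarDeriv q W) =
      (κ / (2 * π)) ^ 2 * (fr.phiFun 0 V * fr.phiFun 0 W + fr.phiFun 1 V * fr.phiFun 1 W) +
        lam ^ 2 * exp (-q 3) ^ 2 * ((sin (q 2) ^ 2 + cos (q 2) ^ 2) *
          ((V 2 + etaFun a V) * (W 2 + etaFun a W) + V 3 * W 3)) := by
  rw [coreForm_apply, fr.phiFun_polarDeriv, fr.phiFun_polarDeriv, fr.phiFun_polarDeriv,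
    fr.phiFun_polarDeriv, etaFun_polarDeriv, etaFun_polarDeriv]
  simp only [polarDeriv_apply, polarMap_apply_two, polarMap_apply_three, mk4_apply_two,
    mk4_apply_three]
  ring

/-- Normal form of the diagonal model through `Lθ`. [folklore] -/
theorem diagMetric_thetaToY (c : Fin 4 → ℝ → ℝ) (q V W : E4) :
    diagMetric (oneVar c) (fr.thetaToY q) (fr.thetaToY V) (fr.thetaToY W) =
      c 0 (q 3) * (⟪xTheta a V, fr.u 0⟫_ℝ * ⟪xTheta a W, fr.u 0⟫_ℝ) +
      c 1 (q 3) * (⟪xTheta a V, fr.u 1⟫_ℝ * ⟪xTheta a W, fr.u 1⟫_ℝ) +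
      c 2 (q 3) * (⟪xTheta a V, fr.u 2⟫_ℝ * ⟪xTheta a W, fr.u 2⟫_ℝ) +
      c 3 (q 3) * (V 3 * W 3) := by
  rw [diagMetric_apply, Fin.sum_univ_four]
  simp only [oneVar, thetaToY_apply, mk4_apply_zero, mk4_apply_one, mk4_apply_two,
    mk4_apply_three]

/-- **The polar identification `Ξ^* F = Lθ^* G`.** If at height `t = q₃` the profile has the
flat-cone form `c₀ = c₁ = κ²`, `c₂ = λ² (2π/L)² e^{-2t}`, `c₃ = λ² e^{-2t}` (`L = ‖a₂‖`, cf.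
`TwoPiProfile.exists_profile`), then for all `V, W`
`F(Ξ q)(DΞ_q V, DΞ_q W) = G(Lθ q)(Lθ V, Lθ W)`, `G = ∑ cᵢ dyᵢ²` the one-variable diagonal model:
the smoothed cusp metric, read in the filling-piece coordinates `(θ₁, θ₂, w)` through
`w = e^{-t} e^{iθ₃}`, is the smooth flat form `F` — "a natural smoothing of this cone
singularity" with cone angle exactly `2π` (Anderson 2006, §2.1; Bleiler–Hodgson 1996, proof of
Thm. 9: `dr² + r² dθ² = |dw|²`). [cite: Anderson2006, §2.1, (2.4)] -/
theorem coreForm_polar (hL : a 2 ≠ 0) {c : Fin 4 → ℝ → ℝ} {κ lam : ℝ} (q : E4)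
    (h0 : c 0 (q 3) = κ ^ 2) (h1 : c 1 (q 3) = κ ^ 2)
    (h2 : c 2 (q 3) = lam ^ 2 * (2 * π / ‖a 2‖) ^ 2 * exp (-2 * q 3))
    (h3 : c 3 (q 3) = lam ^ 2 * exp (-2 * q 3)) (V W : E4) :
    fr.coreForm κ lam (polarMap q) (polarDeriv q V) (polarDeriv q W) =
      diagMetric (oneVar c) (fr.thetaToY q) (fr.thetaToY V) (fr.thetaToY W) := by
  rw [coreForm_polar_lhs, diagMetric_thetaToY, sin_sq_add_cos_sq, one_mul, h0, h1, h2, h3,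
    fr.inner_xTheta_u_zero, fr.inner_xTheta_u_zero, fr.inner_xTheta_u_one,
    fr.inner_xTheta_u_one, fr.inner_xTheta_u_two, fr.inner_xTheta_u_two,
    ← fr.norm_mul_etaFun hL V, ← fr.norm_mul_etaFun hL W]
  have he : exp (-2 * q 3) = exp (-q 3) ^ 2 := by rw [sq, ← Real.exp_add]; ring_nf
  rw [he]
  have hn : ‖a 2‖ ≠ 0 := norm_ne_zero_iff.2 hL
  have hπ : (π : ℝ) ≠ 0 := Real.pi_ne_zero
  field_simp
  ring

end SlopeFrame

end Core

end TwoPiCore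

end Literature.Geometry.Riemannian
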